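import Summits.BirchSwinnertonDyer.Rank1Residual.GaloisImage.SupersingularTwistInertiaOrder
import Summits.BirchSwinnertonDyer.Rank1Residual.GaloisImage.SmallImageInertiaOrder
import Summits.BirchSwinnertonDyer.Rank1Residual.GaloisImage.GL2F3ExponentEight
import HarnessLib

/-!
# `−1 ∈ ρ̄_{E,3}(Γ_ℚ)` for EVERY `E/ℚ` with `E[3]` irreducible, and Sakamoto's (H.3) at level one at
# `p = 3` on every irreducible row — O8-TAME part 11c (all O8 rows at `3`; N2 = X10b)
# (cell `b2b-bsdres`, lane CLASS-CLOSURE, seat cc-typer-1 = typer of record N11 / O8, GEN 10; joint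
# small-image axis O8 / N2 / N3; sequel of `SupersingularTwistInertiaOrder.lean` = part 11b)

HONEST FRAMING (cell `b2b-bsdres`, run/shared/lean/b2b/bsd-rank1-residual/, verbatim in every
file): the goal of the cell is to DELETE the COMBINATION-SHAPED residual classes of the
Birch–Swinnerton-Dyer formula for ALL analytic-rank `≤ 1` elliptic curves over `ℚ` — "full BSD
formula for every rank `≤ 1` curve in class `C`" assembled STRICTLY from published theorems — so
that the rank-`≤ 1` remainder becomes exactly the CONSTRUCTION-SHAPED classes, which are TYPED
(missing-input `Prop`s), NOT attempted. This is not "finishing BSD". THEOREMS ONLY: no definition,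
no named fact, no conjecture node, nothing booked, no label of `RESIDUAL-MAP.md` moved; census
counts are EVIDENCE, never a Literature fact.

## What this file does

Part 11b found `−1` in the INERTIA image on the `(G) ∧ ss` rows and deduced Sakamoto's (H.3) at level
one there without surjectivity. At `p = 3` the GLOBAL image always contains `−1` on an irreducible
row, whatever the reduction type:

* §1 **`exists_smul_eq_neg_three_of_irr_of_not_surj`** — `E[3]` irreducible and `ρ̄_{E,3}` NOT onto
  ⟹ some `z ∈ Γ_ℚ` acts as `−1` on `E[3]`. Proof (group theory of `GL₂(𝔽₃)`, order `48 = 16 · 3`):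
  `G = ρ̄(Γ_ℚ)` has order prime to `3` (GEN 7 `not_dvd_card_map_galoisRepTorsion_of_irr_of_not_surj`,
  Serre 1972 Prop. 15), so by GEN 8's exponent certificate (`g⁸ = 1 ∨ g⁶ = 1` in `GL₂(𝔽₃)`, through
  the tree's frame `exists_frame_galoisRepTorsion_rat`) every element of `G` has `g⁸ = 1`: `G` is a
  `2`-GROUP. It is non-trivial (a trivial image stabilises every line; `E[3]` has one), so its CENTRE
  is non-trivial (Mathlib `IsPGroup.center_nontrivial`) and contains an element of order `2` (Cauchy);
  that central involution commutes with all of `ρ̄(Γ_ℚ)`, which has no stable line (irreducibility), so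
  it is `−1` by part 11a's `smul_eq_neg_of_not_exists_stableLine`.
* §2 **`exists_smul_eq_neg_three_of_irr`** — `Irr W 3` ⟹ some `z ∈ Γ_ℚ` acts as `−1` on `E[3]`
  (surjective case: n1011-p04's `exists_smul_eq_neg_of_hasSurjectiveModNGaloisRep`).
  **`hH3_self_three_of_irr`** — hence Sakamoto's (H.3) at LEVEL ONE (`T = T̄ = E[3]`: every continuous
  crossed homomorphism `Γ_ℚ → E[3]` vanishing on `ker ρ̄_{E,3} ∩ Gal(ℚ̄/ℚ(μ₃))` is principal) holds
  for EVERY `E/ℚ` with `E[3]` irreducible — part 11b's `hH3_self_of_smul_eq_neg`.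
* §3 class forms: **`O8.exists_smul_eq_neg_three`**, **`O8.hH3_self_three`** (every O8 row at `3`:
  `ClassX4 W 3`; census 1 334 rows incl. the niveau-1 cells (M)/(G-ord) where `−1 ∉ ρ̄(I_𝔓)` may
  fail — the involution is then GLOBAL, not inertial); N2: **`ClassX10.exists_smul_eq_neg_three`**,
  **`ClassX10.hH3_self_three`** (X10b rows, `ρ̄_{E,3}` onto or not).

NOT claimed: `p ≥ 5` (an irreducible `G ≤ GL₂(𝔽_p)` of order prime to `p` need not be a `2`-group;
N3 = X9 at `p ∈ {5, 7}` is NOT covered here); `−1 ∈ ρ̄_{E,9}(Γ_ℚ)`; (H.1), (H.2), (H.4), the core rank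
or any level `3^{k+1}`, `k ≥ 1`; any class theorem of BSD type; no label moves.

References: [Serre1972] J.-P. Serre, Invent. Math. 15 (1972) §2.4 Prop. 15, §2.5–2.6 (subgroups of
`GL₂(𝔽₃)`); [Sakamoto2024] R. Sakamoto, JTNB 36 (2024) §2 (H.3); [MazurRubin2004] Lemma 3.5.2;
C.-H. Sah, J. Algebra 10 (1968); [SilvermanAEC2009] *AEC* III.6.4(b).
-/

set_option autoImplicit false

noncomputable section

open scoped Classical NumberField Pointwise

open Field IsDedekindDomain NumberField WeierstrassCurve
  Literature.NumberTheory.EllipticCurves Literature.NumberTheory.GaloisRepresentations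
  Literature.NumberTheory.EllipticCurves.Rank1Residual Rat.HeightOneSpectrum
  Summit.BirchSwinnertonDyer.Rank1Residual.Additive

namespace Summit.BirchSwinnertonDyer.Rank1Residual.GaloisImage

/-! ## §1. Small irreducible image at `3` ⟹ a central involution ⟹ `−1 ∈ ρ̄_{E,3}(Γ_ℚ)` -/

section Three

variable (W : WeierstrassCurve ℚ) [W.IsElliptic]

/-- **`E[3]` irreducible, `ρ̄_{E,3}` not onto ⟹ some `z ∈ Γ_ℚ` acts as `−1` on `E[3]`.** The image
`G = ρ̄_{E,3}(Γ_ℚ) ≤ GL₂(𝔽₃)` has order prime to `3` (Serre Prop. 15), hence exponent dividing `8`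
(GEN 8's `GL₂(𝔽₃)` certificate): a non-trivial `2`-group, whose centre contains an involution; it
commutes with the irreducible action, so it is `−1` (part 11a §1).
[cite: Serre1972, §2.4 Prop. 15 and §2.5] [cite: SilvermanAEC2009, Cor. III.6.4(b)] -/
theorem exists_smul_eq_neg_three_of_irr_of_not_surj (hirr : Irr W 3) (hns : ¬ Surj W 3) :
    ∃ z : absoluteGaloisGroup ℚ, ∀ P : geomTorsion W ((3 : ℕ) : ℤ), z • P = -P := by
  haveI : Fact (Nat.Prime 3) := ⟨Nat.prime_three⟩
  haveI : Fact (Nat.Prime 2) := ⟨Nat.prime_two⟩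
  set ρ := galoisRepTorsion W ((3 : ℕ) : ℤ) with hρ
  -- no `Γ_ℚ`-stable line (irreducibility; `#E[3] = 9`)
  have hE : Nat.card (geomTorsion W ((3 : ℕ) : ℤ)) = 3 ^ 2 :=
    Literature.NumberTheory.EllipticCurves.natCard_geomTorsion W 3
  haveI : Finite (geomTorsion W ((3 : ℕ) : ℤ)) :=
    Nat.finite_of_card_ne_zero (by rw [hE]; decide)
  have hno : ¬ ∃ L : AddSubgroup (geomTorsion W ((3 : ℕ) : ℤ)), Nat.card L = 3 ∧
      ∀ σ ∈ (⊤ : Subgroup (absoluteGaloisGroup ℚ)), ∀ P ∈ L, σ • P ∈ L := by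
    rintro ⟨L, hL, hstab⟩
    rcases hirr L (fun σ P hP ↦ hstab σ (Subgroup.mem_top σ) P hP) with h | h
    · rw [h, AddSubgroup.card_bot] at hL; exact absurd hL (by decide)
    · rw [h, AddSubgroup.card_top, hE] at hL; exact absurd hL (by decide)
  -- a line exists: `ℤ P₀` for `P₀ ≠ 0`
  obtain ⟨P₀, hP₀⟩ : ∃ P : geomTorsion W ((3 : ℕ) : ℤ), P ≠ 0 := by
    have h1 : 1 < Nat.card (geomTorsion W ((3 : ℕ) : ℤ)) := by rw [hE]; decide
    obtain ⟨x, y, hxy⟩ := Finite.one_lt_card_iff_nontrivial.mp h1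
    by_cases hx : x = 0
    · exact ⟨y, fun hy ↦ hxy (hx.trans hy.symm)⟩
    · exact ⟨x, hx⟩
  have hord : addOrderOf P₀ = 3 :=
    addOrderOf_eq_prime (by rw [← natCast_zsmul]; exact natCast_zsmul_eq_zero P₀) hP₀
  -- the image `G` is finite, of order prime to `3`, of exponent dividing `8`: a `2`-group
  set G : Subgroup (Multiplicative (AddAut (geomTorsion W ((3 : ℕ) : ℤ)))) := ρ.range with hG
  haveI : Finite (AddAut (geomTorsion W ((3 : ℕ) : ℤ))) :=
    Finite.of_injective (fun e : AddAut (geomTorsion W ((3 : ℕ) : ℤ)) ↦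
      (e : geomTorsion W ((3 : ℕ) : ℤ) → geomTorsion W ((3 : ℕ) : ℤ))) DFunLike.coe_injective
  haveI : Finite (Multiplicative (AddAut (geomTorsion W ((3 : ℕ) : ℤ)))) :=
    inferInstanceAs (Finite (AddAut (geomTorsion W ((3 : ℕ) : ℤ))))
  have h3 : ¬ 3 ∣ Nat.card G := by
    rw [hG, MonoidHom.range_eq_map]
    exact not_dvd_card_map_galoisRepTorsion_of_irr_of_not_surj W 3 hirr hns ⊤
  obtain ⟨-, Φ, -, -⟩ := exists_frame_galoisRepTorsion_rat W 3
  have h8 : ∀ g : G, g ^ 8 = 1 := by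
    intro g
    rcases GL2F3Cyc.pow_eight_eq_one_or_pow_six_eq_one_of_injective Φ.toMonoidHom Φ.injective
        (g : Multiplicative (AddAut (geomTorsion W ((3 : ℕ) : ℤ)))) with h | h
    · exact Subtype.ext (by rw [Subgroup.coe_pow, h, Subgroup.coe_one])
    · -- `g⁶ = 1`: then `ord(g²) ∣ 3` and `ord(g²) ∣ #G`, so `g² = 1`
      have h6 : g ^ 6 = 1 := Subtype.ext (by rw [Subgroup.coe_pow, h, Subgroup.coe_one])
      have h23 : orderOf (g ^ 2) ∣ 3 :=
        orderOf_dvd_of_pow_eq_one (by rw [← pow_mul]; exact h6)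
      have hG2 : orderOf (g ^ 2) ∣ Nat.card G := orderOf_dvd_natCard _
      have h1 : orderOf (g ^ 2) = 1 := by
        rcases (Nat.dvd_prime Nat.prime_three).mp h23 with h1 | h1
        · exact h1
        · rw [h1] at hG2; exact absurd hG2 h3
      rw [orderOf_eq_one_iff] at h1
      rw [show (8 : ℕ) = 2 * 4 from rfl, pow_mul, h1, one_pow]
  have h2G : IsPGroup 2 G := fun g ↦ ⟨3, by rw [show (2 : ℕ) ^ 3 = 8 from rfl]; exact h8 g⟩
  -- `G` is non-trivial: a trivial image would stabilise the line `ℤ P₀`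
  haveI : Nontrivial G := by
    by_contra htriv
    rw [not_nontrivial_iff_subsingleton] at htriv
    refine hno ⟨AddSubgroup.zmultiples P₀, by rw [Nat.card_zmultiples, hord], fun σ _ P hP ↦ ?_⟩
    have hσ1 : ρ σ = 1 := by
      have : (⟨ρ σ, ⟨σ, rfl⟩⟩ : G) = 1 := Subsingleton.elim _ _
      exact congrArg Subtype.val this
    rw [(galoisRepTorsion_eq_one_iff' W ((3 : ℕ) : ℤ) σ).mp hσ1 P]
    exact hP
  -- a central involution `g₀ = ρ̄(z)`
  haveI : Nontrivial (Subgroup.center G) := h2G.center_nontrivial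
  have hdvd : 2 ∣ Nat.card (Subgroup.center G) := by
    rcases (h2G.to_subgroup (Subgroup.center G)).card_eq_or_dvd with h | h
    · exact absurd h (Finite.one_lt_card.ne')
    · exact h
  obtain ⟨c, hc⟩ := exists_prime_orderOf_dvd_card' 2 hdvd
  set g₀ : G := (c : G) with hg₀
  have hg₀c : g₀ ∈ Subgroup.center G := c.2
  have hg₀ord : orderOf g₀ = 2 := by rw [hg₀, Subgroup.orderOf_coe, hc]
  obtain ⟨z, hz⟩ : ∃ z : absoluteGaloisGroup ℚ, ρ z = (g₀ : Multiplicative (AddAut _)) := g₀.2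
  have hzord : orderOf (ρ z) = 2 := by rw [hz, Subgroup.orderOf_coe, hg₀ord]
  -- `z` is a non-trivial involution on `E[3]` commuting with every `σ`
  have hz2 : ∀ P : geomTorsion W ((3 : ℕ) : ℤ), z • z • P = P := by
    have h1 : ρ (z * z) = 1 := by rw [map_mul, ← pow_two, ← hzord, pow_orderOf_eq_one]
    intro P
    rw [← mul_smul]
    exact (galoisRepTorsion_eq_one_iff' W ((3 : ℕ) : ℤ) _).mp h1 P
  have hz1 : ∃ P : geomTorsion W ((3 : ℕ) : ℤ), z • P ≠ P := by
    by_contra h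
    push Not at h
    have h1 : ρ z = 1 := (galoisRepTorsion_eq_one_iff' W ((3 : ℕ) : ℤ) z).mpr h
    have : orderOf (ρ z) = 1 := by rw [h1, orderOf_one]
    rw [hzord] at this
    exact absurd this (by decide)
  have hcomm : ∀ σ ∈ (⊤ : Subgroup (absoluteGaloisGroup ℚ)), ∀ P : geomTorsion W ((3 : ℕ) : ℤ),
      z • σ • P = σ • z • P := by
    intro σ _ P
    have hσG : ρ σ ∈ G := ⟨σ, rfl⟩
    have hcen : g₀ * ⟨ρ σ, hσG⟩ = ⟨ρ σ, hσG⟩ * g₀ := (Subgroup.mem_center_iff.mp hg₀c ⟨ρ σ, hσG⟩).symm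
    have hc' : ρ (z * σ) = ρ (σ * z) := by
      rw [map_mul, map_mul, hz]
      exact congrArg Subtype.val hcen
    have h1 := congrArg (fun φ ↦ (Multiplicative.toAdd φ) P) hc'
    simp only [hρ, galoisRepTorsion_apply, mul_smul] at h1
    exact h1
  exact ⟨z, smul_eq_neg_of_not_exists_stableLine ⊤ hno z hcomm hz2 hz1⟩

/-- **`E[3]` irreducible ⟹ `−1 ∈ ρ̄_{E,3}(Γ_ℚ)`**: some `z ∈ Γ_ℚ` acts as `−1` on `E[3]`, for EVERY
elliptic curve over `ℚ` with irreducible mod-`3` representation (onto: n1011-p04's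
`exists_smul_eq_neg_of_hasSurjectiveModNGaloisRep`; not onto: §1).
[cite: Serre1972, §2.4 Prop. 15 and §2.5] -/
theorem exists_smul_eq_neg_three_of_irr (hirr : Irr W 3) :
    ∃ z : absoluteGaloisGroup ℚ, ∀ P : geomTorsion W ((3 : ℕ) : ℤ), z • P = -P := by
  haveI : Fact (Nat.Prime 3) := ⟨Nat.prime_three⟩
  by_cases hs : Surj W 3
  · exact exists_smul_eq_neg_of_hasSurjectiveModNGaloisRep W _ hs
  · exact exists_smul_eq_neg_three_of_irr_of_not_surj W hirr hs

/-! ## §2. Sakamoto's (H.3) at level one at `p = 3` on every irreducible row -/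

/-- **(H.3) at level one, `p = 3`, for EVERY `E/ℚ` with `E[3]` irreducible** (surjective or not):
every continuous crossed homomorphism `f : Γ_ℚ → E[3]` vanishing on `ker ρ̄_{E,3} ∩ Gal(ℚ̄/ℚ(μ₃))` is
principal (`−1 ∈ ρ̄(Γ_ℚ)` is central and `−1 − 1 = −2` is invertible on `E[3]`; part 11b's
`hH3_self_of_smul_eq_neg`). [cite: Sakamoto2024, §2 (H.3)] [cite: MazurRubin2004, Lemma 3.5.2]
[cite: Serre1972, §2.4 Prop. 15] -/
theorem hH3_self_three_of_irr (hirr : Irr W 3)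
    (f : contOneCocycles (W.torsionGaloisModule ((3 : ℕ) : ℤ)).toTopRep)
    (hf : ∀ u : absoluteGaloisGroup ℚ, (W.torsionGaloisModule ((3 : ℕ) : ℤ)) u = 1 →
        u ∈ rootsOfUnityFixer ℚ 3 → f.1 u = 0) :
    oneCocycleClass (W.torsionGaloisModule ((3 : ℕ) : ℤ)).toTopRep f = 0 := by
  haveI : Fact (Nat.Prime 3) := ⟨Nat.prime_three⟩
  obtain ⟨z, hz⟩ := exists_smul_eq_neg_three_of_irr W hirr
  exact hH3_self_of_smul_eq_neg W 3 (by decide) z hz f hf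

/-! ## §3. Class forms: O8 at `3` (every row) and N2 = X10b -/

/-- **O8 at `p = 3` (EVERY row, all reduction types: (M), (G-ord), (G-ss), (t′), wild): `−1 ∈ ρ̄_{E,3}(Γ_ℚ)`**
(`ClassX4 W 3`, `¬ Surj W 3`). On the niveau-1 cells the involution is global, not inertial.
[cite: Serre1972, §2.4 Prop. 15 and §2.5] -/
theorem O8.exists_smul_eq_neg_three (hX : ClassX4 W 3) (hns : ¬ Surj W 3) :
    ∃ z : absoluteGaloisGroup ℚ, ∀ P : geomTorsion W ((3 : ℕ) : ℤ), z • P = -P :=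
  exists_smul_eq_neg_three_of_irr_of_not_surj W hX.2.2 hns

/-- **O8 at `p = 3`: Sakamoto's (H.3) at level one on EVERY row** (`ClassX4 W 3`; `ρ̄_{E,3}` onto or
not). [cite: Sakamoto2024, §2 (H.3)] [cite: Serre1972, §2.4 Prop. 15] -/
theorem O8.hH3_self_three (hX : ClassX4 W 3)
    (f : contOneCocycles (W.torsionGaloisModule ((3 : ℕ) : ℤ)).toTopRep)
    (hf : ∀ u : absoluteGaloisGroup ℚ, (W.torsionGaloisModule ((3 : ℕ) : ℤ)) u = 1 →
        u ∈ rootsOfUnityFixer ℚ 3 → f.1 u = 0) :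
    oneCocycleClass (W.torsionGaloisModule ((3 : ℕ) : ℤ)).toTopRep f = 0 :=
  hH3_self_three_of_irr W hX.2.2 f hf

variable {p : ℕ} [Fact p.Prime]

/-- **N2 = X10b (class X10, any `ρ̄_{E,3}`): `−1 ∈ ρ̄_{E,3}(Γ_ℚ)`.** [cite: Serre1972, §2.4 Prop. 15] -/
theorem ClassX10.exists_smul_eq_neg_three [W.IsGloballyMinimal] (h : ClassX10 W p) :
    ∃ z : absoluteGaloisGroup ℚ, ∀ P : geomTorsion W ((3 : ℕ) : ℤ), z • P = -P :=
  exists_smul_eq_neg_three_of_irr W h.2.2.1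

/-- **N2 = X10b: Sakamoto's (H.3) at level one at `3`** on every class-X10 row, surjective image or
not. [cite: Sakamoto2024, §2 (H.3)] [cite: Serre1972, §2.4 Prop. 15] -/
theorem ClassX10.hH3_self_three [W.IsGloballyMinimal] (h : ClassX10 W p)
    (f : contOneCocycles (W.torsionGaloisModule ((3 : ℕ) : ℤ)).toTopRep)
    (hf : ∀ u : absoluteGaloisGroup ℚ, (W.torsionGaloisModule ((3 : ℕ) : ℤ)) u = 1 →
        u ∈ rootsOfUnityFixer ℚ 3 → f.1 u = 0) :
    oneCocycleClass (W.torsionGaloisModule ((3 : ℕ) : ℤ)).toTopRep f = 0 :=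
  hH3_self_three_of_irr W h.2.2.1 f hf

end Three

end Summit.BirchSwinnertonDyer.Rank1Residual.GaloisImage

end
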